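import Literature.AnabelianGeometry.EtaleTheta.SettingModelDeltaThetaInt
import Literature.AnabelianGeometry.EtaleTheta.SettingModelKummerDataEmpty
import Literature.AnabelianGeometry.EtaleTheta.ThetaCyclotomes
import Literature.NumberTheory.EllipticCurves.Kato2004.SemilocalDecompositionProofs
import HarnessLib

/-!
# The Tate-twist datum `CyclotomeMod l N` IS inhabited at the root model for every `N ∣ p − 1`
# (positive half of the root-model census; proof-only)

Mochizuki, *The étale theta function …*, Publ. RIMS **45** (2009) [EtTh], Def. 2.13 p. 46 "the natural isomorphism
`μ_N ≅ (l·Δ_Θ) ⊗ (ℤ/Nℤ)`" [cite: MochizukiEtTh2009, Def 2.13 p.46]. PROOF-ONLY file of the abc-iut cell (prover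
abc-iut-w5-d125 gen 3; NV-L2 row «CyclotomeMod / CyclotomeTower at ThetaSetting.model p»), sequel of
`SettingModelCyclotomeModTwo.lean` (levels `1, 2`). Classical input: "`ℚ_p` contains the `(p−1)`-th roots of unity"
(Serre, *A Course in Arithmetic* II §3.1 Prop. 7, Cor.) — in the tree as
`Literature.NumberTheory.EllipticCurves.Kato2004.padicInt_exists_isPrimitiveRoot_sub_one` (Hensel), consumed by name.

WHAT IS PROVED.
* `galMuN_apply_eq_self_of_dvd_pred` — for `N ∣ p − 1`, `G_{ℚ_p}` fixes `μ_N(ℚ̄_p)` pointwise (every `N`-th root of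
  unity is a power of the image of a primitive one from `ℚ_p`): the mod-`N` cyclotomic character is TRIVIAL;
* **`SettingModel.nonempty_cyclotomeMod_model_of_dvd_pred (hl : l ≠ 0) (hN : N ∣ p − 1)`** — at abc-iut-L2-t1's root
  model the identification `red : l·Δ_Θ = lℤ ↠ μ_N`, `c^{lk} ↦ ζ_N^k`, is onto, has kernel the `N`-th powers, is
  continuous (discrete `(Π^tp_X)^Θ`) and equivariant (both actions trivial: `Δ_Θ` central, abc-iut-w5-d171;
  `μ_N ⊆ ℚ_p`), i.e. `Nonempty ((ThetaSetting.model p).CyclotomeMod l N)`.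

ROOT-MODEL CENSUS for the twist data (with `SettingModelCyclotomeModEmpty` / `RootsOfUnityGaloisNontrivial(OddPrime)`):
`N ∣ p − 1 ⇒ INHABITED`; `p² ∣ N` (any `p`) or `p ∣ N` (odd `p`) `⇒ EMPTY`; other `N` (prime to `p`, not dividing `p − 1`)
not decided here. HONEST FRAMING: about the degenerate model only; nothing asserts that abc is proved or refuted; no side is
taken on [IUTchIII] Cor. 3.12; typed ≠ proved; inhabited ≠ endorsed.
-/

noncomputable section

namespace Literature.AnabelianGeometry.EtaleTheta.SettingModel

open ThetaSetting Literature.AnabelianGeometry.SemiGraphs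
open scoped commutatorElement

variable (p : ℕ) [hp : Fact p.Prime]

/-! ### `μ_N(ℚ̄_p) ⊆ ℚ_p` for `N ∣ p − 1` -/

/-- A primitive `N`-th root of unity IN `ℚ_p` for every `N ∣ p − 1` (from the primitive `(p−1)`-th root of unity of
`ℤ_p`, Hensel — the tree's `Kato2004.padicInt_exists_isPrimitiveRoot_sub_one`). [cite: Serre1973, Ch. II §3.1 Prop. 7] -/
theorem exists_isPrimitiveRoot_padic_of_dvd_pred (N : ℕ+) (hN : (N : ℕ) ∣ p - 1) :
    ∃ ζ : ℚ_[p], IsPrimitiveRoot ζ N := by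
  obtain ⟨ζ, hζ⟩ := Literature.NumberTheory.EllipticCurves.Kato2004.padicInt_exists_isPrimitiveRoot_sub_one p
  have hζ' : IsPrimitiveRoot (ζ : ℚ_[p]) (p - 1) :=
    hζ.map_of_injective (f := PadicInt.Coe.ringHom) (fun a b h => Subtype.ext h)
  have hpos : 0 < p - 1 := by have := hp.out.two_le; omega
  exact ⟨(ζ : ℚ_[p]) ^ ((p - 1) / N), hζ'.pow hpos (Nat.div_mul_cancel hN).symm⟩

/-- **For `N ∣ p − 1`, `G_{ℚ_p}` fixes `μ_N(ℚ̄_p)` pointwise** (each `N`-th root of unity is a power of the image of a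
primitive one lying in `ℚ_p`). [cite: Serre1973, Ch. II §3.1 Prop. 7] -/
theorem galMuN_apply_eq_self_of_dvd_pred (N : ℕ+) (hN : (N : ℕ) ∣ p - 1) (σ : GQp p) (u : MuN p N) :
    galMuN p N σ u = u := by
  obtain ⟨ζ, hζ⟩ := exists_isPrimitiveRoot_padic_of_dvd_pred p N hN
  have hζ' : IsPrimitiveRoot (algebraMap ℚ_[p] (PadicAlgCl p) ζ) N :=
    hζ.map_of_injective (f := algebraMap ℚ_[p] (PadicAlgCl p)) (algebraMap ℚ_[p] (PadicAlgCl p)).injective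
  have huN : (((u : (PadicAlgCl p)ˣ)) : PadicAlgCl p) ^ (N : ℕ) = 1 := by
    have h := (mem_rootsOfUnity _ _).mp u.2
    rw [← Units.val_pow_eq_pow_val, h, Units.val_one]
  haveI : NeZero (N : ℕ) := ⟨N.ne_zero⟩
  obtain ⟨i, -, hi⟩ := hζ'.eq_pow_of_pow_eq_one huN
  apply Subtype.ext
  apply Units.ext
  rw [galMuN_apply_coe, ← hi, ← map_pow, AlgEquiv.commutes]

/-! ### `CyclotomeMod l N` at the root model for `N ∣ p − 1` -/

/-- **`CyclotomeMod l N` is INHABITED at the root model for every `N ∣ p − 1`** (`l ≠ 0`): with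
`e : Δ_Θ(model) ≃* ℤ` (`exists_mulEquiv_deltaTheta_int`), `l·Δ_Θ = l·ℤ` and `red : l·k ↦ ζ_N^k ∈ μ_N` for a primitive
`ζ_N ∈ μ_N(ℚ̄_p)` is onto with kernel the `N`-th powers, continuous, and equivariant since both actions are trivial
(`Δ_Θ` central, abc-iut-w5-d171; `μ_N ⊆ ℚ_p`, `galMuN_apply_eq_self_of_dvd_pred`). [cite: MochizukiEtTh2009, Def 2.13 p.46] -/
theorem nonempty_cyclotomeMod_model_of_dvd_pred (l : ℕ) (hl : l ≠ 0) (N : ℕ+) (hN : (N : ℕ) ∣ p - 1) :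
    Nonempty ((ThetaSetting.model p).CyclotomeMod l N) := by
  obtain ⟨e, -⟩ := exists_mulEquiv_deltaTheta_int p
  set D := ThetaSetting.model p with hD
  -- a primitive `N`-th root of unity `ε ∈ μ_N(ℚ̄_p)`
  haveI : NeZero ((N : ℕ) : PadicAlgCl p) := ⟨by exact_mod_cast N.ne_zero⟩
  obtain ⟨ζ0, hζ0⟩ := HasEnoughRootsOfUnity.prim (M := PadicAlgCl p) (n := (N : ℕ))
  haveI : NeZero (N : ℕ) := ⟨N.ne_zero⟩
  set ε : MuN p N := hζ0.toRootsOfUnity with hε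
  have hεprim : IsPrimitiveRoot ε (N : ℕ) := by
    have hinj : Function.Injective
        ((Units.coeHom (PadicAlgCl p)).comp (rootsOfUnity N (PadicAlgCl p)).subtype) := by
      intro a b h
      exact Subtype.ext (Units.ext h)
    refine IsPrimitiveRoot.of_map_of_injective
      (f := (Units.coeHom (PadicAlgCl p)).comp (rootsOfUnity N (PadicAlgCl p)).subtype) ?_ hinj
    show IsPrimitiveRoot (((ε : (PadicAlgCl p)ˣ)) : PadicAlgCl p) N
    rw [hε, IsPrimitiveRoot.val_toRootsOfUnity_coe]
    exact hζ0
  have hl0 : (l : ℤ) ≠ 0 := by exact_mod_cast hl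
  have hN0 : ((N : ℕ) : ℤ) ≠ 0 := by exact_mod_cast N.ne_zero
  -- the `ℤ`-coordinate of `l·Δ_Θ` and its divisibility by `l`
  let m : D.lDeltaTheta l → ℤ := fun x => Multiplicative.toAdd (e ⟨x.1, D.lDeltaTheta_le l x.2⟩)
  have hm_mul : ∀ x y : D.lDeltaTheta l, m (x * y) = m x + m y := fun x y => by
    show Multiplicative.toAdd (e ⟨(x * y : D.lDeltaTheta l).1, _⟩) = _
    have : (⟨(x * y : D.lDeltaTheta l).1, D.lDeltaTheta_le l (x * y).2⟩ : D.DeltaTheta) =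
        ⟨x.1, D.lDeltaTheta_le l x.2⟩ * ⟨y.1, D.lDeltaTheta_le l y.2⟩ := rfl
    rw [this, map_mul, toAdd_mul]
  have hm_pow : ∀ (x : D.lDeltaTheta l) (n : ℕ), m (x ^ n) = n * m x := fun x n => by
    induction n with
    | zero =>
      show Multiplicative.toAdd (e ⟨(x ^ 0 : D.lDeltaTheta l).1, _⟩) = _
      have h1 : (⟨(x ^ 0 : D.lDeltaTheta l).1, D.lDeltaTheta_le l (x ^ 0).2⟩ : D.DeltaTheta) = 1 := by
        apply Subtype.ext; simp
      rw [h1, map_one, toAdd_one]; simp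
    | succ n ih => rw [pow_succ, hm_mul, ih, Nat.cast_succ]; ring
  have hm_dvd : ∀ x : D.lDeltaTheta l, (l : ℤ) ∣ m x := by
    rintro ⟨x, y, hy, rfl⟩
    refine ⟨Multiplicative.toAdd (e ⟨y, hy⟩), ?_⟩
    show Multiplicative.toAdd (e ⟨y ^ l, _⟩) = _
    have : (⟨y ^ l, D.lDeltaTheta_le l ⟨y, hy, rfl⟩⟩ : D.DeltaTheta) = ⟨y, hy⟩ ^ l := rfl
    rw [this, map_pow, toAdd_pow, nsmul_eq_mul]
  have hm_inj : ∀ x y : D.lDeltaTheta l, m x = m y → x = y := fun x y h => by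
    have h' : e ⟨x.1, D.lDeltaTheta_le l x.2⟩ = e ⟨y.1, D.lDeltaTheta_le l y.2⟩ :=
      Multiplicative.toAdd.injective h
    have h'' := congrArg Subtype.val (e.injective h')
    exact Subtype.ext h''
  -- `red x := ε ^ (m x / l)`
  let red : D.lDeltaTheta l →* MuN p N :=
    { toFun := fun x => ε ^ (m x / l)
      map_one' := by
        have : m 1 = 0 := by
          show Multiplicative.toAdd (e ⟨(1 : D.lDeltaTheta l).1, _⟩) = 0
          have h1 : (⟨(1 : D.lDeltaTheta l).1, D.lDeltaTheta_le l (1 : D.lDeltaTheta l).2⟩ :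
            D.DeltaTheta) = 1 := rfl
          rw [h1, map_one, toAdd_one]
        simp only [this, Int.zero_ediv, zpow_zero]
      map_mul' := fun x y => by
        obtain ⟨a, ha⟩ := hm_dvd x
        obtain ⟨b, hb⟩ := hm_dvd y
        simp only [hm_mul, ha, hb, ← mul_add, Int.mul_ediv_cancel_left _ hl0, zpow_add] }
  have hred : ∀ x, red x = ε ^ (m x / l) := fun _ => rfl
  -- the generator `c^l` of `l·Δ_Θ`, with `m = l`
  obtain ⟨c, hc1⟩ : ∃ c : D.DeltaTheta, Multiplicative.toAdd (e c) = 1 :=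
    ⟨e.symm (Multiplicative.ofAdd 1), by simp⟩
  have hcl : (c.1 ^ l) ∈ D.lDeltaTheta l := ⟨c.1, c.2, rfl⟩
  have hmcl : m ⟨c.1 ^ l, hcl⟩ = l := by
    show Multiplicative.toAdd (e ⟨c.1 ^ l, _⟩) = l
    have : (⟨c.1 ^ l, D.lDeltaTheta_le l hcl⟩ : D.DeltaTheta) = c ^ l := rfl
    rw [this, map_pow, toAdd_pow, nsmul_eq_mul, hc1, mul_one]
  haveI : DiscreteTopology D.GtpTheta := QuotientGroup.discreteTopology (isOpen_discrete _)
  refine ⟨{ red := red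
            red_surjective := ?_
            red_ker := ?_
            continuous_red := continuous_of_discreteTopology
            red_conj := ?_ }⟩
  · -- onto `μ_N = ⟨ε⟩`
    intro u
    have huN : (((u : (PadicAlgCl p)ˣ)) : PadicAlgCl p) ^ (N : ℕ) = 1 := by
      have h := (mem_rootsOfUnity _ _).mp u.2
      rw [← Units.val_pow_eq_pow_val, h, Units.val_one]
    obtain ⟨i, -, hi⟩ := hζ0.eq_pow_of_pow_eq_one huN
    refine ⟨⟨c.1 ^ l, hcl⟩ ^ i, ?_⟩
    rw [map_pow, hred, hmcl, Int.ediv_self hl0, zpow_one]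
    apply Subtype.ext; apply Units.ext
    rw [← hi, SubgroupClass.coe_pow, Units.val_pow_eq_pow_val, hε, IsPrimitiveRoot.val_toRootsOfUnity_coe]
  · -- kernel = `N`-th powers
    intro x
    rw [hred, hεprim.zpow_eq_one_iff_dvd]
    obtain ⟨a, ha⟩ := hm_dvd x
    rw [ha, Int.mul_ediv_cancel_left _ hl0]
    constructor
    · rintro ⟨j, rfl⟩
      refine ⟨⟨(c.1 ^ j) ^ l, ⟨c.1 ^ j, Subgroup.zpow_mem _ c.2 j, rfl⟩⟩, hm_inj _ _ ?_⟩
      rw [ha, hm_pow]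
      have hmj : m ⟨(c.1 ^ j) ^ l, ⟨c.1 ^ j, Subgroup.zpow_mem _ c.2 j, rfl⟩⟩ = l * j := by
        show Multiplicative.toAdd (e ⟨(c.1 ^ j) ^ l, _⟩) = _
        have : (⟨(c.1 ^ j) ^ l, D.lDeltaTheta_le l ⟨c.1 ^ j, Subgroup.zpow_mem _ c.2 j, rfl⟩⟩ :
            D.DeltaTheta) = (c ^ j) ^ l := rfl
        rw [this, map_pow, map_zpow, toAdd_pow, toAdd_zpow, smul_eq_mul, nsmul_eq_mul, hc1, mul_one]
      rw [hmj]; ring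
    · rintro ⟨y, hy⟩
      have hxy : m x = (N : ℕ) * m y := by rw [hy, hm_pow]
      obtain ⟨b, hb⟩ := hm_dvd y
      refine ⟨b, ?_⟩
      have : (l : ℤ) * a = l * ((N : ℕ) * b) := by rw [← ha, hxy, hb]; ring
      have := mul_left_cancel₀ hl0 this
      rw [this]
  · -- equivariance: both actions are trivial
    intro σ x
    rw [galMuN_apply_eq_self_of_dvd_pred p N hN]
    congr 1
    apply Subtype.ext
    exact toTheta_conj_eq_of_mem_deltaTheta p _ x.1 (D.lDeltaTheta_le l x.2)

/-- Census form: for `N ∣ p − 1` the root interface plus its guard are CONSISTENT with the level-`N` twist datum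
(whereas for `p² ∣ N` they do not imply it, `SettingModelCyclotomeModEmpty`). [cite: MochizukiEtTh2009, Def 2.13 p.46] -/
theorem exists_isEtThOrigin_nonempty_cyclotomeMod_of_dvd_pred (l : ℕ) (hl : l ≠ 0) (N : ℕ+)
    (hN : (N : ℕ) ∣ p - 1) : ∃ D : ThetaSetting p, D.IsEtThOrigin ∧ Nonempty (D.CyclotomeMod l N) :=
  ⟨ThetaSetting.model p, ThetaSetting.model_isEtThOrigin p, nonempty_cyclotomeMod_model_of_dvd_pred p l hl N hN⟩

end Literature.AnabelianGeometry.EtaleTheta.SettingModel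

end
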